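import Summits.ABC.IUTFork.Cor312Ind3Real
import Summits.ABC.IUTFork.Cor312Ind3Analytic
import Summits.ABC.IUTFork.Thm311RealLog
import Summits.ABC.IUTFork.Cor312Ind3RealIterates
import Literature.IUT.LogThetaLattice.VerticallyCoricLGPArch
import HarnessLib

/-!
# [IUTchIII] Cor. 3.12, TEAM B row B-3 (assembly): (Ind3) at the CANONICAL analytic instance —
# every containment hypothesis discharged

Record-only file (D-0012) of the abc-iut cell (Cor. 3.12 strategy TEAM B «estimate / log-Kummer» of
HUMAN RULING D-0067 (3), row B-3 of `HOME/plan/C312-TEAMS.md`, seat abc-iut-c312-12 = B2; assembly of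
`Cor312Ind3Real` p411624 + `Cor312Ind3Analytic` p412063 + `Thm311RealLog` p411812); TAKES NO SIDE.

`Column.ind3_of_componentwise_logShellsDH` (p411624) proves the (Ind3) containments of [IUTchIII]
Thm. 3.11 (ii) for any column over the Dupuy–Hilado shells whose images are `tprodImages` of per-place
components, with two containment hypotheses left open: `hUiterNon` (nonarch iterate components in the
shell) and `hUiterArc` (arch iterate components in the ball). This file CLOSES BOTH at the canonical
analytic family `Real.analyticLogv F` (p411812):

* `Real.canonicalComponents` — the canonical per-place component data: at `m' = 0` the honest unit sets
  (`unitsSet`); at `m' ≥ 1` and a finite place the analytic iterate images (`analyticIterImage` at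
  `p = p_v`, the image of the portion of `𝒪_v^×` on which the `m'`-th iterate of the log-link is
  defined, Rmk. 1.1.1 (i)); at `m' ≥ 1` and an archimedean place the image of the portion of the units
  on which the `m'`-th PRINCIPAL-branch iterate is defined (`arcIterDomain`, `VerticallyCoricLGPArch`
  p411153), read back along `extensionEmbedding : K_w →+* ℂ`;
* `Real.canonicalComponents_arch_subset_shell` — the arch iterate components lie in the shell
  (`arcIterDomain ⊆ 𝒪^× ⊆ ℐ`, preimage-monotone: the shell at `.inl w` IS the `extensionEmbedding`
  preimage of `arcLogShell` by definition);
* **`Column.ind3_canonical`** — **(Ind3) HOLDS, with NO containment hypothesis left**, for any column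
  over `logShellsDH X (analyticLogv F)` whose `unitImage`/`ballImage` are the `tprodImages` of the
  canonical components resp. of the shells: `hlaw` is `logvLaw_analyticLogv` (p411812), `hUiterNon` is
  `analyticIterImage_subset_shell_of_formula` at the formula clause `analyticLogv_apply` (p412063 /
  p411812), `hUiterArc` is the previous item. What remains hypothetical is only what MUST be: the
  equations tying the column's binders to these components (the instance definition itself — the
  faithfulness of reading the printed `unitImage`s as exactly these sets is the typer-side claim, cited
  per component in the docstrings of the inputs).

TEAM A consumption (row A-1, p411096): a column satisfying the equations now has `Column.Ind3` outright,
so `LogvolCoarse.unitImage_logvol_le_shellPk` ("(Ind3) → inequality from above", Step (x)) applies with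
no (Ind3) debt. Sources: [IUTchIII] pp. 104–105 (Prop. 3.5 (ii) (a), (b)), p. 156 (Thm. 3.11 (ii)
(Ind3)), pp. 28, 36–37 (Rmk. 1.1.1 (i), Rmk. 1.2.2 (i)–(iii)).
[claim: Mochizuki2012, status: disputed]
Deliberately NOT here: (ii) (b)'s surjection clause (the landed `prop35ii_b_arcExp` carries it at the
model level), the log-volume consequences (B-2/B-4, landed), any judgement on Cor. 3.12.
-/

noncomputable section

open Set

namespace Summit.ABC.IUTFork.Thm311

open Literature.IUT.LogVolume Literature.IUT.LogThetaLattice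
open NumberField IsDedekindDomain

namespace Real

variable {F : Type} [Field F] [NumberField F]

/-- **The canonical per-place component data of the log-Kummer images** ([IUTchIII] Prop. 3.5 (ii) (a),
(b)): at `m' = 0` the honest unit sets; at `m' ≥ 1` the image of the portion of the units on which the
`m'`-th iterate of the log-link is defined — at a finite place through the analytic `p_v`-adic logarithm
(`analyticIterImage`, Rmk. 1.1.1 (i)), at an archimedean place through the principal branch
(`arcIterDomain`, read back along `extensionEmbedding`). [claim: Mochizuki2012, status: disputed] -/
def canonicalComponents (m' : ℕ) : ∀ x : Place F, Set (Carrier x) :=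
  fun x => match m', x with
  | 0, x => unitsSet x
  | m' + 1, .inl w => (InfinitePlace.Completion.extensionEmbedding w) ⁻¹' arcIterDomain (m' + 1)
  | m' + 1, .inr v =>
      haveI : Fact (residueChar F v).Prime := ⟨residueChar_prime F v⟩
      analyticIterImage (residueChar F v) v (natCast_residueChar_mem F v) (m' + 1)

/-- At `m' = 0` the canonical components are the unit sets. [folklore] -/
theorem canonicalComponents_zero (x : Place F) :
    canonicalComponents (F := F) 0 x = unitsSet x := by
  cases x <;> rfl

/-- **The archimedean iterate components lie in the shell** (`arcIterDomain m' ⊆ 𝒪^× ⊆ ℐ ⊆ ℂ`,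
pulled back: the shell at `.inl w` IS the `extensionEmbedding`-preimage of `arcLogShell`).
[claim: Mochizuki2012, status: disputed] -/
theorem canonicalComponents_arch_subset_shell (logv : PadicLogs F) (w : InfinitePlace F)
    {m' : ℕ} (hm' : 1 ≤ m') :
    canonicalComponents (F := F) m' (.inl w) ⊆ shell logv (.inl w) := by
  obtain ⟨n, rfl⟩ : ∃ n, m' = n + 1 := ⟨m' - 1, by omega⟩
  intro a ha
  show InfinitePlace.Completion.extensionEmbedding w a ∈ arcLogShell
  exact arcUnits_subset_arcLogShell
    (arcIterDomain_subset_arcUnits (by omega) (ha : _ ∈ arcIterDomain (n + 1)))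

/-- **The nonarchimedean iterate components lie in the shell of the canonical analytic family**
(`analyticIterImage_subset_shell_of_formula` at the formula clause `analyticLogv_apply`).
[claim: Mochizuki2012, status: disputed] -/
theorem canonicalComponents_nonarch_subset_shell (v : HeightOneSpectrum (𝓞 F))
    {m' : ℕ} (hm' : 1 ≤ m') :
    canonicalComponents (F := F) m' (.inr v) ⊆ shell (analyticLogv F) (.inr v) := by
  obtain ⟨n, rfl⟩ : ∃ n, m' = n + 1 := ⟨m' - 1, by omega⟩
  haveI : Fact (residueChar F v).Prime := ⟨residueChar_prime F v⟩
  exact analyticIterImage_subset_shell_of_formula (residueChar F v) v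
    (natCast_residueChar_mem F v) (analyticLogv F) rfl (fun u => analyticLogv_apply F v u)
    (by omega)

end Real

namespace Column

open Real

variable {F : Type} [Field F] [NumberField F]

/-- **[IUTchIII] Thm. 3.11 (ii) (Ind3) AT THE CANONICAL ANALYTIC INSTANCE — every containment
hypothesis discharged**: for any column over the Dupuy–Hilado shells at the canonical analytic family
(`logShellsDH X (analyticLogv F)`, law = `logvLaw_analyticLogv`) whose transported unit images are the
`tprodImages` of the canonical components and whose ball images are the `tprodImages` of the shells,
the (Ind3) containments hold outright. The only hypotheses are the two EQUATIONS defining the instance.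
[claim: Mochizuki2012, status: disputed] -/
theorem ind3_canonical (X : PilotData F)
    (C : Column (logShellsDH X (analyticLogv F))) (D : MRData (logShellsDH X (analyticLogv F)))
    (hpk : ∀ (j : (thetaIndex X).Label) (vQ : (thetaIndex X).VQ),
      ((logShellsDH X (analyticLogv F)).shellPk j vQ :
        Set ((logShellsDH X (analyticLogv F)).Packet j vQ)) ⊆ D.shellPk j vQ)
    (hunit : ∀ (m : ℤ) (m' : ℕ) (j : (thetaIndex X).Label) (vQ : (thetaIndex X).VQ),
      C.unitImage m m' j vQ = (logShellsDH X (analyticLogv F)).tprodImages j vQ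
        (fun v => canonicalComponents m' v.1))
    (hball : ∀ (m : ℤ) (j : (thetaIndex X).Label) (vQ : (thetaIndex X).VQ),
      C.ballImage m j vQ = (logShellsDH X (analyticLogv F)).tprodImages j vQ
        (fun v => shell (analyticLogv F) v.1)) :
    C.Ind3 D := by
  refine ind3_of_componentwise_logShellsDH X (analyticLogv F) (logvLaw_analyticLogv F) C D hpk
    (fun _ m' _ v => canonicalComponents m' v.1) (fun m vQ v => canonicalComponents_zero v.1)
    ?_ ?_ (fun m m' j vQ => hunit m m' j vQ) hball
  · -- nonarch iterates
    intro m m' hm' vQ hv v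
    obtain ⟨x, hover⟩ := v
    rcases x with w | v'
    · rw [← hover] at hv
      exact (hv : False).elim
    · exact canonicalComponents_nonarch_subset_shell v' hm'
  · -- arch iterates: components lie in the shells (= the ball components)
    intro m m' hm' vQ _ v
    obtain ⟨x, hover⟩ := v
    rcases x with w | v'
    · exact canonicalComponents_arch_subset_shell (analyticLogv F) w hm'
    · exact canonicalComponents_nonarch_subset_shell v' hm'

end Column

end Summit.ABC.IUTFork.Thm311

end

/-! ## Correction of record (audit F-w5d163-1, 2026-08-26T00:25:59Z) and convergence to the honest images

The arch branch of `canonicalComponents` at `m' ≥ 1` is the iterate DOMAIN `D_{m'}` (the portion of the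
units on which the `m'`-th principal-branch iterate is defined, p411153 `arcIterDomain`), NOT the printed
IMAGE of the iterate ([IUTchIII] Prop. 3.5 (ii) (a) (2)/(b); Rmk. 1.2.2 (iii) "the images, via the
composite … with the various iterates") — audit finding F-w5d163-1 (MEDIUM, semantic; no theorem above is
false: `D_{m'} ⊆ 𝒪^× ⊆ ℐ`, and TEAM A's consumer uses the nonarch clause only). The COMPONENTS OF RECORD
for the iterate images at `m' ≥ 1` are abc-iut-w4-d029's honest family `honestU`/`iterImage`
(`Cor312Ind3RealIterates`, p412330: nonarch `log_v`-images, arch principal-`log`-images through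
`extensionEmbedding`), which consumes `Column.ind3_of_componentwise_logShellsDH` above. Below:
`Column.ind3_canonical_honest` — the CANONICAL analytic instance re-pointed at the honest images (the
corrected form of `Column.ind3_canonical`; its two iterate hypotheses are discharged inside p412330) —
and the kernel form of the finding itself (`canonicalComponents_one_inl_ne_iterImage`: the landed arch
component and the honest image differ already at `m' = 1`: `0` lies in the image of the logarithm on the
units, not in the unit circle). `canonicalComponents` stays as landed (gate append-only); consumers
should instantiate `unitImage` with the honest components. -/

noncomputable section

namespace Summit.ABC.IUTFork.Thm311

open Literature.IUT.LogVolume Literature.IUT.LogThetaLattice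
open NumberField IsDedekindDomain

namespace Real

variable {F : Type} [Field F] [NumberField F]

/-- **The kernel form of audit finding F-w5d163-1**: at every archimedean place the landed arch component
(`arcIterDomain`-preimage, a set of UNITS) differs from the honest iterate image already at `m' = 1` —
`0 = log 1` lies in the image of the principal logarithm on the units but has norm `0 ≠ 1`.
[claim: Mochizuki2012, status: disputed] -/
theorem canonicalComponents_one_inl_ne_iterImage (w : InfinitePlace F) :
    canonicalComponents (F := F) 1 (.inl w) ≠ iterImage (analyticLogv F) 1 (.inl w) := by
  intro h
  have h0 : (0 : Carrier (.inl w : Place F)) ∈ iterImage (analyticLogv F) 1 (.inl w) := by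
    refine ⟨1, ?_, ?_, ?_⟩
    · show ‖(1 : Carrier (.inl w : Place F))‖ = 1
      exact norm_one
    · show ‖(1 : Carrier (.inl w : Place F))‖ = 1
      exact norm_one
    · show InfinitePlace.Completion.extensionEmbedding w (0 : w.Completion) =
          Complex.log (InfinitePlace.Completion.extensionEmbedding w (1 : w.Completion))
      rw [map_zero, map_one, Complex.log_one]
  rw [← h] at h0
  have h0' : InfinitePlace.Completion.extensionEmbedding w
      (0 : Carrier (.inl w : Place F)) ∈ arcIterDomain 1 := h0
  rw [arcIterDomain_one] at h0'
  have hn : ‖InfinitePlace.Completion.extensionEmbedding w (0 : w.Completion)‖ = 1 := h0'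
  rw [map_zero, norm_zero] at hn
  norm_num at hn

end Real

namespace Column

open Real

variable {F : Type} [Field F] [NumberField F]

/-- **The CANONICAL ANALYTIC (Ind3) INSTANCE, corrected per F-w5d163-1 — the honest iterate images at
the analytic family**: for any column over `logShellsDH X (analyticLogv F)` whose unit images are the
`tprodImages` of abc-iut-w4-d029's HONEST components (`honestU` at `logv := Real.analyticLogv F`:
units at `m' = 0`; `log_v`- resp. principal-`log`-iterate IMAGES at `m' ≥ 1`) and whose ball images are
the `tprodImages` of the shells, the (Ind3) containments hold outright — `law` = `logvLaw_analyticLogv`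
(p411812), everything else discharged inside p412330. This supersedes `ind3_canonical` as the canonical
statement (whose arch components were the iterate domains). [claim: Mochizuki2012, status: disputed] -/
theorem ind3_canonical_honest (X : PilotData F)
    (C : Column (logShellsDH X (analyticLogv F))) (D : MRData (logShellsDH X (analyticLogv F)))
    (hpk : ∀ (j : (thetaIndex X).Label) (vQ : (thetaIndex X).VQ),
      ((logShellsDH X (analyticLogv F)).shellPk j vQ :
        Set ((logShellsDH X (analyticLogv F)).Packet j vQ)) ⊆ D.shellPk j vQ)
    (hunit : ∀ (m : ℤ) (m' : ℕ) (j : (thetaIndex X).Label) (vQ : (thetaIndex X).VQ),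
      C.unitImage m m' j vQ = (logShellsDH X (analyticLogv F)).tprodImages j vQ
        (honestU X (analyticLogv F) m m' vQ))
    (hball : ∀ (m : ℤ) (j : (thetaIndex X).Label) (vQ : (thetaIndex X).VQ),
      C.ballImage m j vQ = (logShellsDH X (analyticLogv F)).tprodImages j vQ
        (fun v => shell (analyticLogv F) v.1)) :
    C.Ind3 D :=
  Column.ind3_logShellsDH_of_honestImages X (analyticLogv F) (logvLaw_analyticLogv F) C D hpk
    hunit hball

end Column

end Summit.ABC.IUTFork.Thm311

end
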